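import Summits.Ventures.PercRepro.Night2FatXLinesThree

/-!
# night-2: the fat case of (FAIR) from one free point — all targets through `x` and `y` unloaded, `N ≥ 8`

If some point `y ∈ W ∖ {x}` has every target `T ⊇ Q ∪ {x, y}` unloaded (e.g. `y` on no basis line, when the loads
are at distance one: `exists_basis_line_of_dist_one_fat`), the binomial criterion of `basis_pair_fair_of_fat_count_sum`
holds from the targets through `x, y` alone once `N = |G ∖ Q| ≥ 8`: at level `j ≥ 2` they number at least
`C(N − 2, j − 2)` (`choose_le_card_targets_level`), each contributes `fatTerm j capS ≥ (110/221)/C(j + 3, 4)`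
(`fat_count_level_ge_pair`), and the levels `1`–`5` give `(110/221)(1 + 1/5 + 6/15 + 15/35 + 20/70) = 1.152` at
`N = 8`, more for larger `N` (`fat_count_numeric_pair`).  **`basis_pair_fair_fat_of_free_point`**.
Paper `proofs/NIGHT-2-g33.md` §6 (d).
-/

namespace PercRepro.Shadow

open PercRepro.ThmH PercRepro.PerFlat

variable {α : Type*} [DecidableEq α] {M : Matroid α} [M.Finite] {G : Finset α}

/-- **The level-`j` part of the fat count sum from the targets through `x` and `y`**: at least
`C(N − 2, j − 2) · fatTerm j c_j` when every such target at level `j` is unloaded. -/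
theorem fat_count_level_ge_pair (hG : G ∈ flatsQ M (5 + 1)) (hd : (gr M \ G).card = 2) (hk : kColoops M G = 1)
    {B : Finset α} (hB : B ∈ thinMembers M 5 G) (hnP : ¬ bigP M G B) {z : α} (hz : z ∈ G \ clF M B) {x y : α}
    (hx : x ∈ G \ insert z B) (hy : y ∈ G \ insert z B) (hxy : x ≠ y) {j : ℕ} (hj : 2 ≤ j)
    (hload : ∀ T ∈ tgtSets M 5 G B z, x ∈ T → y ∈ T → (T \ insert z B).card = j →
      dload M 5 G (bigP M G) (dshGT2 M 5 G) T = 0) :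
    ((((G \ insert z B).card - 2).choose (j - 2) : ℕ) : ℚ) *
      fatTerm j (if (G \ insert z B).card - j ≤ 3 then 1 else 11 / 18) ≤
      ∑ T ∈ ((tgtSets M 5 G B z).filter
        (fun T => x ∈ T ∧ dload M 5 G (bigP M G) (dshGT2 M 5 G) T = 0)).filter
        (fun T => (T \ insert z B).card = j),
        capS M 5 G T / ((221 / 360 : ℚ) * ((2 * ((T \ coloops M G).card - 2).choose 4 : ℕ) : ℚ)) := by
  have hQG : insert z B ⊆ G :=
    Finset.insert_subset (Finset.mem_sdiff.1 hz).1 (subset_G_of_mem_thinMembers hB)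
  have hd' : (gr M \ G).card ≤ 5 := by omega
  have hKQ : coloops M G ⊆ insert z B :=
    (coloops_subset_of_mem_thinMembers hG hd' hB).trans (Finset.subset_insert _ _)
  have hX : ({x, y} : Finset α) ⊆ G \ insert z B := by
    intro e he
    rw [Finset.mem_insert, Finset.mem_singleton] at he
    rcases he with rfl | rfl
    · exact hx
    · exact hy
  have hX2 : ({x, y} : Finset α).card = 2 := Finset.card_pair hxy
  have hcount := choose_le_card_targets_level hG hB hz hX (by omega : 1 ≤ j) (by rw [hX2]; exact hj)
  rw [hX2] at hcount
  set F := ((tgtSets M 5 G B z).filter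
    (fun T => x ∈ T ∧ dload M 5 G (bigP M G) (dshGT2 M 5 G) T = 0)).filter
    (fun T => (T \ insert z B).card = j) with hF
  set c : ℚ := if (G \ insert z B).card - j ≤ 3 then 1 else 11 / 18 with hc
  have hsub : (tgtSets M 5 G B z).filter (fun T => {x, y} ⊆ T ∧ (T \ insert z B).card = j) ⊆ F := by
    intro T hT
    rw [Finset.mem_filter] at hT
    rw [hF, Finset.mem_filter, Finset.mem_filter]
    have hxT : x ∈ T := hT.2.1 (Finset.mem_insert_self _ _)
    have hyT : y ∈ T := hT.2.1 (Finset.mem_insert_of_mem (Finset.mem_singleton_self _))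
    exact ⟨⟨hT.1, hxT, hload T hT.1 hxT hyT hT.2.2⟩, hT.2.2⟩
  have hcard : ((((G \ insert z B).card - 2).choose (j - 2) : ℕ) : ℚ) ≤ (F.card : ℚ) := by
    exact_mod_cast hcount.trans (Finset.card_le_card hsub)
  have hterm : ∀ T ∈ F, fatTerm j c ≤
      capS M 5 G T / ((221 / 360 : ℚ) * ((2 * ((T \ coloops M G).card - 2).choose 4 : ℕ) : ℚ)) := by
    intro T hT
    rw [hF, Finset.mem_filter, Finset.mem_filter] at hT
    obtain ⟨⟨hTt, -, -⟩, hTj⟩ := hT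
    have hTG : T ⊆ G := subset_G_of_mem_shadowAt (mem_tgtSets.1 hTt).1
    have hTK : (T \ coloops M G).card = j + 5 := by
      rw [card_sdiff_coloops_eq_level_add_five hG hd hk hB hnP hz hTt, hTj]
    have hGT : (G \ T).card = (G \ insert z B).card - j := by
      have hQT : insert z B ⊆ T := (mem_tgtSets.1 hTt).2.1
      have h1 : G \ insert z B = (G \ T) ∪ (T \ insert z B) := by
        ext e
        simp only [Finset.mem_sdiff, Finset.mem_union]
        constructor
        · rintro ⟨heG, heQ⟩
          by_cases heT : e ∈ T
          · exact Or.inr ⟨heT, heQ⟩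
          · exact Or.inl ⟨heG, heT⟩
        · rintro (⟨heG, heT⟩ | ⟨heT, heQ⟩)
          · exact ⟨heG, fun h => heT (hQT h)⟩
          · exact ⟨hTG heT, heQ⟩
      have hdisj : Disjoint (G \ T) (T \ insert z B) := by
        rw [Finset.disjoint_left]
        intro e h1 h2
        exact (Finset.mem_sdiff.1 h1).2 (Finset.mem_sdiff.1 h2).1
      rw [h1, Finset.card_union_of_disjoint hdisj, hTj]
      omega
    have hcap : c ≤ capS M 5 G T := by
      rw [hc]
      split_ifs with h3
      · rw [capS_eq_one_of_card_sdiff_le_three hd (by rw [hGT]; exact h3)]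
      · exact capS_ge_eleven_eighteenths_two_one hd hk hTG
    unfold fatTerm
    rw [hTK, show j + 5 - 2 = j + 3 by omega]
    apply div_le_div_of_nonneg_right hcap
    positivity
  calc ((((G \ insert z B).card - 2).choose (j - 2) : ℕ) : ℚ) * fatTerm j c
      ≤ (F.card : ℚ) * fatTerm j c := by
        apply mul_le_mul_of_nonneg_right hcard
        unfold fatTerm
        rw [hc]
        split_ifs <;> positivity
    _ = ∑ _T ∈ F, fatTerm j c := by rw [Finset.sum_const, nsmul_eq_mul]
    _ ≤ ∑ T ∈ F, capS M 5 G T /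
        ((221 / 360 : ℚ) * ((2 * ((T \ coloops M G).card - 2).choose 4 : ℕ) : ℚ)) :=
        Finset.sum_le_sum hterm

/-- The fat count sum dominates the sum of its levels `1`–`5`. -/
theorem fat_count_sum_ge_levels_one_to_five (hG : G ∈ flatsQ M (5 + 1)) (hd : (gr M \ G).card = 2)
    {B : Finset α} {z : α} {x : α} :
    (∑ j ∈ ({1, 2, 3, 4, 5} : Finset ℕ), ∑ T ∈ ((tgtSets M 5 G B z).filter
        (fun T => x ∈ T ∧ dload M 5 G (bigP M G) (dshGT2 M 5 G) T = 0)).filter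
        (fun T => (T \ insert z B).card = j),
        capS M 5 G T / ((221 / 360 : ℚ) * ((2 * ((T \ coloops M G).card - 2).choose 4 : ℕ) : ℚ))) ≤
    ∑ T ∈ (tgtSets M 5 G B z).filter
        (fun T => x ∈ T ∧ dload M 5 G (bigP M G) (dshGT2 M 5 G) T = 0),
        capS M 5 G T / ((221 / 360 : ℚ) * ((2 * ((T \ coloops M G).card - 2).choose 4 : ℕ) : ℚ)) := by
  have hd' : (gr M \ G).card ≤ 5 := by omega
  set F := (tgtSets M 5 G B z).filter
    (fun T => x ∈ T ∧ dload M 5 G (bigP M G) (dshGT2 M 5 G) T = 0) with hF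
  set f : Finset α → ℚ := fun T =>
    capS M 5 G T / ((221 / 360 : ℚ) * ((2 * ((T \ coloops M G).card - 2).choose 4 : ℕ) : ℚ)) with hf
  have hf0 : ∀ T ∈ F, 0 ≤ f T := fun T _ => div_nonneg (capS_nonneg' hG hd' T) (by positivity)
  set J : Finset ℕ := {1, 2, 3, 4, 5} with hJ
  have hfib := Finset.sum_fiberwise_of_maps_to (s := F.filter (fun T => (T \ insert z B).card ∈ J)) (t := J)
    (g := fun T => (T \ insert z B).card) (f := f) (fun T hT => (Finset.mem_filter.1 hT).2)
  have hinner : ∀ j ∈ J, (F.filter (fun T => (T \ insert z B).card ∈ J)).filter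
      (fun T => (T \ insert z B).card = j) = F.filter (fun T => (T \ insert z B).card = j) := by
    intro j hj
    ext T
    simp only [Finset.mem_filter]
    constructor
    · rintro ⟨⟨h1, -⟩, h2⟩
      exact ⟨h1, h2⟩
    · rintro ⟨h1, h2⟩
      exact ⟨⟨h1, h2 ▸ hj⟩, h2⟩
  calc ∑ j ∈ J, ∑ T ∈ F.filter (fun T => (T \ insert z B).card = j), f T
      = ∑ j ∈ J, ∑ T ∈ (F.filter (fun T => (T \ insert z B).card ∈ J)).filter
          (fun T => (T \ insert z B).card = j), f T := by
        apply Finset.sum_congr rfl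
        intro j hj
        rw [hinner j hj]
    _ = ∑ T ∈ F.filter (fun T => (T \ insert z B).card ∈ J), f T := hfib
    _ ≤ ∑ T ∈ F, f T := by
        apply Finset.sum_le_sum_of_subset_of_nonneg (Finset.filter_subset _ _)
        intro T hT _
        exact hf0 T hT

/-- **The numerical core for one free point**: for `N ≥ 8` the level `1` and the levels `2`–`5` through `x, y`
give at least `1`. -/
theorem fat_count_numeric_pair (N : ℕ) (hN : 8 ≤ N) :
    (1 : ℚ) ≤ (((N - 1).choose 0 : ℕ) : ℚ) * fatTerm 1 (if N - 1 ≤ 3 then 1 else 11 / 18) +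
      ((((N - 2).choose 0 : ℕ) : ℚ) * fatTerm 2 (if N - 2 ≤ 3 then 1 else 11 / 18) +
      (((N - 2).choose 1 : ℕ) : ℚ) * fatTerm 3 (if N - 3 ≤ 3 then 1 else 11 / 18) +
      (((N - 2).choose 2 : ℕ) : ℚ) * fatTerm 4 (if N - 4 ≤ 3 then 1 else 11 / 18) +
      (((N - 2).choose 3 : ℕ) : ℚ) * fatTerm 5 (if N - 5 ≤ 3 then 1 else 11 / 18)) := by
  unfold fatTerm
  have hc0 : (((N - 1).choose 0 : ℕ) : ℚ) = 1 := by simp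
  have hc0' : (((N - 2).choose 0 : ℕ) : ℚ) = 1 := by simp
  have h6 : (6 : ℚ) ≤ (((N - 2).choose 1 : ℕ) : ℚ) := by
    rw [Nat.choose_one_right]
    exact_mod_cast (by omega : 6 ≤ N - 2)
  have h15 : (15 : ℚ) ≤ (((N - 2).choose 2 : ℕ) : ℚ) := by
    have : (6 : ℕ).choose 2 ≤ (N - 2).choose 2 := Nat.choose_le_choose 2 (by omega)
    have h : (6 : ℕ).choose 2 = 15 := by decide
    exact_mod_cast (h ▸ this)
  have h20 : (20 : ℚ) ≤ (((N - 2).choose 3 : ℕ) : ℚ) := by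
    have : (6 : ℕ).choose 3 ≤ (N - 2).choose 3 := Nat.choose_le_choose 3 (by omega)
    have h : (6 : ℕ).choose 3 = 20 := by decide
    exact_mod_cast (h ▸ this)
  have hif : ∀ k : ℕ, (if N - k ≤ 3 then (1 : ℚ) else 11 / 18) ≥ 11 / 18 := by
    intro k
    split_ifs <;> norm_num
  rw [hc0, hc0']
  have h1 : (11 / 18 : ℚ) / ((221 / 360 : ℚ) * ((2 * (1 + 3).choose 4 : ℕ) : ℚ)) ≤
      1 * ((if N - 1 ≤ 3 then (1 : ℚ) else 11 / 18) / ((221 / 360 : ℚ) * ((2 * (1 + 3).choose 4 : ℕ) : ℚ))) := by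
    rw [one_mul]
    apply div_le_div_of_nonneg_right (hif 1)
    positivity
  have h2 : (11 / 18 : ℚ) / ((221 / 360 : ℚ) * ((2 * (2 + 3).choose 4 : ℕ) : ℚ)) ≤
      1 * ((if N - 2 ≤ 3 then (1 : ℚ) else 11 / 18) / ((221 / 360 : ℚ) * ((2 * (2 + 3).choose 4 : ℕ) : ℚ))) := by
    rw [one_mul]
    apply div_le_div_of_nonneg_right (hif 2)
    positivity
  have h3 : (6 : ℚ) * ((11 / 18 : ℚ) / ((221 / 360 : ℚ) * ((2 * (3 + 3).choose 4 : ℕ) : ℚ))) ≤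
      (((N - 2).choose 1 : ℕ) : ℚ) * ((if N - 3 ≤ 3 then (1 : ℚ) else 11 / 18) /
        ((221 / 360 : ℚ) * ((2 * (3 + 3).choose 4 : ℕ) : ℚ))) := by
    apply mul_le_mul h6 (div_le_div_of_nonneg_right (hif 3) (by positivity)) (by positivity) (Nat.cast_nonneg _)
  have h4 : (15 : ℚ) * ((11 / 18 : ℚ) / ((221 / 360 : ℚ) * ((2 * (4 + 3).choose 4 : ℕ) : ℚ))) ≤
      (((N - 2).choose 2 : ℕ) : ℚ) * ((if N - 4 ≤ 3 then (1 : ℚ) else 11 / 18) /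
        ((221 / 360 : ℚ) * ((2 * (4 + 3).choose 4 : ℕ) : ℚ))) := by
    apply mul_le_mul h15 (div_le_div_of_nonneg_right (hif 4) (by positivity)) (by positivity) (Nat.cast_nonneg _)
  have h5 : (20 : ℚ) * ((11 / 18 : ℚ) / ((221 / 360 : ℚ) * ((2 * (5 + 3).choose 4 : ℕ) : ℚ))) ≤
      (((N - 2).choose 3 : ℕ) : ℚ) * ((if N - 5 ≤ 3 then (1 : ℚ) else 11 / 18) /
        ((221 / 360 : ℚ) * ((2 * (5 + 3).choose 4 : ℕ) : ℚ))) := by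
    apply mul_le_mul h20 (div_le_div_of_nonneg_right (hif 5) (by positivity)) (by positivity) (Nat.cast_nonneg _)
  have hnum : (1 : ℚ) ≤ (11 / 18 : ℚ) / ((221 / 360 : ℚ) * ((2 * (1 + 3).choose 4 : ℕ) : ℚ)) +
      ((11 / 18 : ℚ) / ((221 / 360 : ℚ) * ((2 * (2 + 3).choose 4 : ℕ) : ℚ)) +
      (6 : ℚ) * ((11 / 18 : ℚ) / ((221 / 360 : ℚ) * ((2 * (3 + 3).choose 4 : ℕ) : ℚ))) +
      (15 : ℚ) * ((11 / 18 : ℚ) / ((221 / 360 : ℚ) * ((2 * (4 + 3).choose 4 : ℕ) : ℚ))) +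
      (20 : ℚ) * ((11 / 18 : ℚ) / ((221 / 360 : ℚ) * ((2 * (5 + 3).choose 4 : ℕ) : ℚ)))) := by
    norm_num [Nat.choose]
  linarith

/-- **The fat case of (FAIR) from one free point**: with the fat split and a point `y ∈ W ∖ {x}` such that every
target through `x` and `y` is unloaded, and `N = |G ∖ Q| ≥ 8`, the pair receives its fair share. -/
theorem basis_pair_fair_fat_of_free_point (hG : G ∈ flatsQ M (5 + 1)) (hd : (gr M \ G).card = 2)
    (hk : kColoops M G = 1) (hs : ∀ e ∈ gr M, ∀ f ∈ gr M, e ≠ f → rkN M {e, f} = 2)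
    (hl : ∀ e ∈ gr M, M.Indep {e}) (hfat : (fatClosures M 5 G 2).card ≤ 1)
    {B₀ : Finset α} (hB₀ : B₀ ∈ thinMembers M 5 G) {w₀ x : α} (hD : G \ clF M B₀ = {w₀, x}) (hne : w₀ ≠ x)
    {B : Finset α} (hB : B ∈ thinMembers M 5 G) (hnP : ¬ bigP M G B) {z : α} (hz : z ∈ G \ clF M B)
    (hl0 : loss M 5 G B z ≠ 0) (hw₀ : w₀ ∈ insert z B) (hx : x ∉ insert z B) {y : α}
    (hy : y ∈ G \ insert z B) (hxy : x ≠ y) (hN : 8 ≤ (G \ insert z B).card)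
    (hload : ∀ T ∈ tgtSets M 5 G B z, x ∈ T → y ∈ T → dload M 5 G (bigP M G) (dshGT2 M 5 G) T = 0) :
    loss M 5 G B z ≤ rhoL M 5 G B z * lossIncomeH M 5 G (bigP M G) (dshGT2 M 5 G) B z := by
  have hxG : x ∈ G \ insert z B := by
    refine Finset.mem_sdiff.2 ⟨?_, hx⟩
    have : x ∈ G \ clF M B₀ := by
      rw [hD]
      exact Finset.mem_insert_of_mem (Finset.mem_singleton_self _)
    exact (Finset.mem_sdiff.1 this).1
  apply basis_pair_fair_of_fat_count_sum hG hd hk hs hl hfat hB₀ hD hne hB hnP hz hl0 hw₀ hx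
  have hl1 := fat_count_level_ge' hG hd hk hB hnP hz hxG (j := 1) (by norm_num)
    (fun T hT _ h1 => dload_eq_zero_of_card_sdiff_le_six hG hd hk hs hl
      (by rw [card_sdiff_coloops_eq_level_add_five hG hd hk hB hnP hz hT, h1]))
  have hl2 := fat_count_level_ge_pair hG hd hk hB hnP hz hxG hy hxy (j := 2) (by norm_num)
    (fun T hT hxT hyT _ => hload T hT hxT hyT)
  have hl3 := fat_count_level_ge_pair hG hd hk hB hnP hz hxG hy hxy (j := 3) (by norm_num)
    (fun T hT hxT hyT _ => hload T hT hxT hyT)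
  have hl4 := fat_count_level_ge_pair hG hd hk hB hnP hz hxG hy hxy (j := 4) (by norm_num)
    (fun T hT hxT hyT _ => hload T hT hxT hyT)
  have hl5 := fat_count_level_ge_pair hG hd hk hB hnP hz hxG hy hxy (j := 5) (by norm_num)
    (fun T hT hxT hyT _ => hload T hT hxT hyT)
  have hlev := fat_count_sum_ge_levels_one_to_five hG hd (B := B) (z := z) (x := x)
  have hnum := fat_count_numeric_pair (G \ insert z B).card hN
  rw [Finset.sum_insert (by decide), Finset.sum_insert (by decide), Finset.sum_insert (by decide),
    Finset.sum_insert (by decide), Finset.sum_singleton] at hlev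
  simp only [Nat.sub_self] at hl1 hl2 hl3 hl4 hl5
  linarith

end PercRepro.Shadow
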